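import Summits.QuantumFields.YangMills.Theorems.AlphaInputsT3ACv3NewtonLiftFramedLinearisation
import Summits.QuantumFields.YangMills.Theorems.AlphaInputsT3ACv3NewtonShellRegional
import Summits.QuantumFields.YangMills.Theorems.AlphaInputsT3ACv3NewtonLiftFlat
import HarnessLib

/-!
# `AlphaInputsT3ACv3NewtonLiftRegional` — STRATEGY B for 2′, the (FL) row under OWNER RULING g24-№4: **THE REGIONAL NEWTON LIFT WITH AN ABSTRACT KERNEL** — an exact `k`-fold (0.4)-lift
# on a SET `C` of constrained coarse bonds from a candidate that is flat only IN LOCAL STENCIL GAUGES, for ANY `ℝ`-linear kernel `R₀` with the three framed rows (ii) approximate right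
# inverse ∕ (iii) sup ∕ curl-in-a-gauge — lane `pub-balaban3d` ∕ cell `ym3-torus`, seat `ym-ust-19936-w4` (g2)

WHY (cell `ym3-torus` 2026-08-28: ★★OWNER g25 02:16:33Z «(r1) of record = ONE global shell», 03:01:17Z∕03:02:25Z «(r1-ob): kernel of record := ★alpha-2 g6's one-block exact lift `obLift`
… ★w4-19936 g2 — keep `R₀` ABSTRACT»; ★w1-19936 g2 LEAD memo v3).  The model lift `NewtonLiftFlat.exists_exact_lift_flat_allL` (this seat, g0) needs a GLOBALLY flat candidate and the
specific kernel `liftS`.  The `hLift` binder of `…v3InnerLiftFromRegionalThm1` constrains the averages on `C = bondsIn k Ω` only, its START (LEAD (S5)∕(S6)) is flat only in one-box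
gauges, and the kernel of record is still moving (`liftSMTw` → `obLift`).  THIS FILE proves the regional theorem ONCE for every kernel:
* §1 letters: `star_conj_mem_lieSU`, `conj_mem_lieSU'` (conjugations by `SU(n)` preserve `𝔰𝔲(n)`).
* §2 ★★★ `exists_exact_lift_regional_allL` — INPUTS: `k ≤ m + K` (every `L ≥ 2`); a set `C` of level-`k` bonds; per `c ∈ C` a finest gauge `σ_c` and a stencil `N_c ⊇ B^k(c₋) ∪ B^k(c₊)`
  with `‖(U₀^{σ_c})_b − 1‖ ≤ η` on the bonds inside `N_c` and `‖Ū₀^{(k)}(c)V(c)* − 1‖ ≤ η₀`; an `ℝ`-linear kernel `R₀` on plain one-forms which, on `𝔰𝔲(n)`-valued inputs supported on `C`,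
  is `𝔰𝔲(n)`-valued, has `‖R₀ u‖ ≤ (C_R∕L^k)‖u‖`, and is a `κ`-approximate right inverse of the FRAMED linearisation at every `c ∈ C`
  (`‖h_c*·Q^{(k)}(σ_c·R₀u·σ_c*)(c)·h_c − u(c)‖ ≤ κ‖u‖`, `h_c = σ_c^{(k)}(c₋)` — ★w3∕(C) supply this for `liftSMTw`, the `obLift` port likewise); the smallness rows of the flat AllL lift
  with `C_S ↦ C_R` and `κ` added to the contraction row.  OUTPUT: `u` (`𝔰𝔲(n)`-valued, supported on `C`, `‖u‖ ≤ 4η₀`), `a = R₀ u` (`‖a_b‖ ≤ 4C_Rη₀∕L^k`), `U = e^{a}U₀` with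
  `Ū^{(k)} = V` EXACTLY ON `C` — by (A) `NewtonShell.exists_zero_on_support_of_approxRightInverse` with (i) = (B) `NewtonLiftFramed.norm_mlogDefect_sub_sub_framedAvg_le_allL`, `Good` = (B)
  `norm_defect_sub_one_le_framed_allL`, exactness = `NewtonDefectMap.eq_of_mlog_mul_star_eq_zero`.
* §3 ★★ `dist1_plaqHol_regional_le` — THE PLAQUETTE CLAUSE for such an output at ANY finest plaquette `p` and ANY gauge `g` in which `U₀` is `η_p`-flat on `p`'s bonds, given the
  kernel's curl row in that gauge (`‖curl(g·R₀u·g*)(p)‖ ≤ (C_curl∕(L^k)²)‖u‖`, ★w3 (r1-curl) ∕ (C) `norm_curlM_conj_liftSMTw_le`): `dist1 U(∂p) ≤ dist1 U₀(∂p) + (4C_curl + 64C_R(L^kη_p) + 256C_R²η₀)·η₀∕(L^k)²`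
  (this seat's `PerturbedPlaquetteFrame.dist1_plaqHol_perturb_le_frame`).
HONEST FRAMING.  The gauges, stencils, kernel rows and the START are INPUTS; this is the regional shell's assembly, not `hLift` itself ((S5)∕(S6) + a kernel certificate + the window
bookkeeping remain); the stub 2′χ, the crux `HistoryTailL` and any gap are NOT claimed; count-neutral helper toward R3 2′ (items 19936∕19935); registry untouched; nothing about d = 4,
the continuum, or a mass gap; YM₃ on T³ is rung R3, not Clay.

References: T. Bałaban, Commun. Math. Phys. 102 (1985) 277–309 [Balaban1985Variational] (Thm 1 (8) p.279, (11)–(15) pp.279–280); CMP 98 (1985) 17–51 [Balaban1985Averaging] ((11)–(13)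
p.19, (19)–(23) p.21, Props. 4–5 pp.38–42); CMP 109 (1987) 249–301 [Balaban1987RG1] ((0.4), (0.11) p.253).
-/

set_option autoImplicit false

noncomputable section

open scoped Matrix.Norms.L2Operator
open NormedSpace
namespace Summit.QuantumFields.YangMills.Theorems.NewtonLiftFramed

open Literature.MathematicalPhysics.QuantumFieldTheory.Balaban1983to89
open Literature.MathematicalPhysics.QuantumFieldTheory.Balaban1983to89.MatrixLog (mlog norm_mlog_le_two_mul)
open Literature.MathematicalPhysics.QuantumFieldTheory.Balaban1983to89.T4AdjointCovarianceUnitary (lieSU mem_lieSU_iff expSU coe_expSU)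
open Literature.MathematicalPhysics.QuantumFieldTheory.Balaban1983to89.B5Eq118OneStroke (iterBlockOf)
open T4Continuum BlockAveraging ExpMeanLog
open Summit.QuantumFields.YangMills.Theorems.LinearLiftMatrix (linAvgIterM linAvgIterM_mem avgCLM avgCLM_apply curlM)
open Summit.QuantumFields.YangMills.Theorems.NewtonShell (exists_zero_on_support_of_approxRightInverse)
open Summit.QuantumFields.YangMills.Theorems.NewtonDefectMap (eq_of_mlog_mul_star_eq_zero)
open Summit.QuantumFields.YangMills.Theorems.NewtonLiftFlat (mlog_defect_mem_lieSU)
open Summit.QuantumFields.YangMills.Theorems.PerturbedPlaquette (exp_four_mul_sub_le_sq norm_conj_SU)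
open Summit.QuantumFields.YangMills.Theorems.PerturbedPlaquetteFrame (dist1_plaqHol_perturb_le_frame)
open Summit.QuantumFields.YangMills.Theorems.Prop7HolRatioPerStep (coe_star_mul_self coe_mul_star_self)

variable {n : Type*} [Fintype n] [DecidableEq n] {P : Params}

/-! ## §1 Letters: conjugation by `SU(n)` preserves `𝔰𝔲(n)` -/

/-- `g·X·g* ∈ 𝔰𝔲(n)` for `X ∈ 𝔰𝔲(n)`, `g ∈ SU(n)`. [folklore] -/
theorem conj_mem_lieSU' {X : Matrix n n ℂ} (hX : X ∈ lieSU n) (g : Matrix.specialUnitaryGroup n ℂ) :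
    (g : Matrix n n ℂ) * X * star (g : Matrix n n ℂ) ∈ lieSU n := by
  rw [mem_lieSU_iff] at hX ⊢
  refine ⟨by rw [star_mul, star_mul, star_star, hX.1]; noncomm_ring, ?_⟩
  rw [Matrix.trace_mul_cycle, coe_star_mul_self, one_mul, hX.2]

/-- `g*·X·g ∈ 𝔰𝔲(n)` for `X ∈ 𝔰𝔲(n)`, `g ∈ SU(n)`. [folklore] -/
theorem star_conj_mem_lieSU {X : Matrix n n ℂ} (hX : X ∈ lieSU n) (g : Matrix.specialUnitaryGroup n ℂ) :
    star (g : Matrix n n ℂ) * X * (g : Matrix n n ℂ) ∈ lieSU n := by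
  rw [mem_lieSU_iff] at hX ⊢
  refine ⟨by rw [star_mul, star_mul, star_star, hX.1]; noncomm_ring, ?_⟩
  rw [Matrix.trace_mul_cycle, coe_mul_star_self, one_mul, hX.2]

/-! ## §2 The regional Newton lift, abstract kernel -/

section Regional

variable [Nonempty n]

set_option maxHeartbeats 800000 in
/-- **★★★ THE REGIONAL NEWTON LIFT WITH AN ABSTRACT KERNEL, AT EVERY `L ≥ 2`** (`k ≤ m + K`).  DATA: a set `C` of level-`k` bonds; gauges `σ : PBond P k → GaugeTransf P 0 SU(n)` and
stencils `N : PBond P k → Set (Site P 0)` with `N c ⊇ B^k(c₋) ∪ B^k(c₊)` for `c ∈ C`; a finest field `U₀` with `‖(U₀^{σ_c})_b − 1‖ ≤ η` on the bonds inside `N_c` and a level-`k` field `V` with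
`‖Ū₀^{(k)}(c)·V(c)* − 1‖ ≤ η₀`, both for `c ∈ C`; an `ℝ`-linear kernel `R₀` which on `𝔰𝔲(n)`-valued inputs supported on `C` (α) is `𝔰𝔲(n)`-valued, (β) has `‖R₀ u‖ ≤ (C_R∕L^k)·‖u‖`, (γ) satisfies
`‖h_c*·Q^{(k)}(b ↦ σ_c(b₋)·(R₀ u)_b·σ_c(b₋)*)(c)·h_c − u(c)‖ ≤ κ·‖u‖` at every `c ∈ C` (`h_c = σ_c^{(k)}(c₋)`); a radius `0 < r ≤ 1/4`; smallness (`m′(x) = (d+1)L^k x`, `ρ_D = 2m′(2r)+η₀`,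
`C_A = (d+1)C_S·5200ℓ²∕(L(L−1))`, bracket `β′ = 8ρ_D + 2C_A(m′(4r)+m′(2r+η)) + (2r+η) + (2m′(η)+η₀)`): `C_A(m′(4r)+m′(2r+η)) ≤ 1`, `200ℓ(…) ≤ 1`, `4ℓ(…) < δ_N`, `ρ_D ≤ 1/4`, `|n|ρ_D < π`,
`κ + (d+1)·C_R·β′ ≤ 1/2`, `4C_R·η₀ ≤ r·L^k`.  THEN there are `u` (`𝔰𝔲(n)`-valued, `u c = 0` off `C`, `‖u‖ ≤ 4η₀`), the correction `a = R₀ u` (`𝔰𝔲(n)`-valued, `‖a_b‖ ≤ 4C_R·η₀∕L^k`) and the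
field `U_b = e^{a_b}U₀,b` with `Ū^{(k)}(c) = V(c)` for EVERY `c ∈ C`.  (Shell (A) on supports; (i) = (B) framed AllL row per `c ∈ C`; `Good` = (B); exactness = `eq_of_mlog_mul_star_eq_zero`.)
[cite: Balaban1985Variational, Thm 1 (8) p.279, (11)–(15) pp.279–280; Balaban1985Averaging, (11)–(13) p.19, Props. 4–5 pp.38–42] -/
theorem exists_exact_lift_regional_allL {k : ℕ} (hk : k ≤ P.m + P.K) (C : Set (PBond P k))
    (σ : PBond P k → GaugeTransf P 0 (Matrix.specialUnitaryGroup n ℂ)) (N : PBond P k → Set (Site P 0))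
    (hN : ∀ c ∈ C, ∀ x : Site P 0, (iterBlockOf k x = c.src ∨ iterBlockOf k x = c.tgt) → x ∈ N c)
    (U₀ : GaugeField P 0 (Matrix.specialUnitaryGroup n ℂ)) (V : GaugeField P k (Matrix.specialUnitaryGroup n ℂ))
    (R₀ : (PBond P k → Matrix n n ℂ) →ₗ[ℝ] (PBond P 0 → Matrix n n ℂ))
    {r η η₀ CR κ : ℝ} (hr : 0 < r) (hr4 : r ≤ 1 / 4) (hη : 0 ≤ η) (hη₀ : 0 ≤ η₀) (hCR : 0 < CR) (hκ : 0 ≤ κ)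
    (hU₀ : ∀ c ∈ C, ∀ b : PBond P 0, b.src ∈ N c → b.tgt ∈ N c → ‖((GaugeField.gaugeAct (σ c) U₀ b : Matrix.specialUnitaryGroup n ℂ) : Matrix n n ℂ) - 1‖ ≤ η)
    (hV : ∀ c ∈ C, ‖((Averaging.iter (fun i => blockAvg (P := P) (j := i) (expMeanLogSU (n := n))) k U₀ c : Matrix.specialUnitaryGroup n ℂ) : Matrix n n ℂ) *
        star ((V c : Matrix.specialUnitaryGroup n ℂ) : Matrix n n ℂ) - 1‖ ≤ η₀)
    (hRS : ∀ u : PBond P k → Matrix n n ℂ, (∀ c, u c ∈ lieSU n) → (∀ c, c ∉ C → u c = 0) → ∀ b, R₀ u b ∈ lieSU n)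
    (hRn : ∀ u : PBond P k → Matrix n n ℂ, (∀ c, u c ∈ lieSU n) → (∀ c, c ∉ C → u c = 0) → ‖R₀ u‖ ≤ (CR / (P.L : ℝ) ^ k) * ‖u‖)
    (hRinv : ∀ u : PBond P k → Matrix n n ℂ, (∀ c, u c ∈ lieSU n) → (∀ c, c ∉ C → u c = 0) → ∀ c ∈ C,
      ‖star (transfUp (σ c) k c.src : Matrix n n ℂ) * linAvgIterM k (fun b => ((σ c b.src : Matrix.specialUnitaryGroup n ℂ) : Matrix n n ℂ) * R₀ u b * star (σ c b.src : Matrix n n ℂ)) c *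
          (transfUp (σ c) k c.src : Matrix n n ℂ) - u c‖ ≤ κ * ‖u‖)
    (h5200 : (((P.d : ℝ) + 1) * ((18 : ℝ) ^ P.d * (2 + ((P.d : ℝ) + 1) * (18 : ℝ) ^ P.d)) * (5200 * (((P.d + 2) * P.L : ℕ) : ℝ) ^ 2) / ((P.L : ℝ) * ((P.L : ℝ) - 1))) *
      ((((P.d : ℝ) + 1) * (P.L : ℝ) ^ k * (4 * r)) + (((P.d : ℝ) + 1) * (P.L : ℝ) ^ k * (2 * r + η))) ≤ 1)
    (h200 : 200 * (((P.d + 2) * P.L : ℕ) : ℝ) * ((((P.d : ℝ) + 1) * (P.L : ℝ) ^ k * (4 * r)) + (((P.d : ℝ) + 1) * (P.L : ℝ) ^ k * (2 * r + η))) ≤ 1)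
    (hNδ : 4 * (((P.d + 2) * P.L : ℕ) : ℝ) *
      ((((P.d : ℝ) + 1) * (P.L : ℝ) ^ k * (4 * r)) + (((P.d : ℝ) + 1) * (P.L : ℝ) ^ k * (2 * r + η))) < deltaSU n)
    (hρD : 2 * ((((P.d : ℝ) + 1) * (P.L : ℝ) ^ k * (2 * r))) + η₀ ≤ 1 / 4)
    (hρπ : (Fintype.card n : ℝ) * (2 * ((((P.d : ℝ) + 1) * (P.L : ℝ) ^ k * (2 * r))) + η₀) < Real.pi)
    (hcontr : κ + ((P.d : ℝ) + 1) * CR *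
      (8 * (2 * ((((P.d : ℝ) + 1) * (P.L : ℝ) ^ k * (2 * r))) + η₀) +
          2 * (((P.d : ℝ) + 1) * ((18 : ℝ) ^ P.d * (2 + ((P.d : ℝ) + 1) * (18 : ℝ) ^ P.d)) * (5200 * (((P.d + 2) * P.L : ℕ) : ℝ) ^ 2) / ((P.L : ℝ) * ((P.L : ℝ) - 1))) *
            ((((P.d : ℝ) + 1) * (P.L : ℝ) ^ k * (4 * r)) + (((P.d : ℝ) + 1) * (P.L : ℝ) ^ k * (2 * r + η))) +
          (2 * r + η) + (2 * ((((P.d : ℝ) + 1) * (P.L : ℝ) ^ k * η)) + η₀)) ≤ 1 / 2)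
    (hdef : 4 * CR * η₀ ≤ r * (P.L : ℝ) ^ k) :
    ∃ (U : GaugeField P 0 (Matrix.specialUnitaryGroup n ℂ)) (u : PBond P k → Matrix n n ℂ) (a : PBond P 0 → Matrix n n ℂ),
      (∀ c, u c ∈ lieSU n) ∧ (∀ c, c ∉ C → u c = 0) ∧ ‖u‖ ≤ 4 * η₀ ∧ a = R₀ u ∧ (∀ b, a b ∈ lieSU n) ∧
      (∀ b, ‖a b‖ ≤ 4 * CR * η₀ / (P.L : ℝ) ^ k) ∧
      (∀ b, ((U b : Matrix.specialUnitaryGroup n ℂ) : Matrix n n ℂ) = exp (a b) * (U₀ b : Matrix n n ℂ)) ∧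
      (∀ c ∈ C, Averaging.iter (fun i => blockAvg (P := P) (j := i) (expMeanLogSU (n := n))) k U c = V c) := by
  classical
  -- letters
  set av : (i : ℕ) → Averaging P i (Matrix.specialUnitaryGroup n ℂ) := fun i => blockAvg (P := P) (j := i) (expMeanLogSU (n := n)) with hav
  set Lk : ℝ := (P.L : ℝ) ^ k with hLk
  have hLk0 : 0 < Lk := by rw [hLk]; have := P.L_pos; positivity
  have hr1 : r ≤ 1 := by linarith
  have hr2 : r ≤ 1 / 2 := by linarith
  have hL1 : (1 : ℝ) < P.L := by exact_mod_cast P.hL.2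
  have hLL : 0 < (P.L : ℝ) * ((P.L : ℝ) - 1) := mul_pos (by linarith) (by linarith)
  set CA : ℝ := (((P.d : ℝ) + 1) * ((18 : ℝ) ^ P.d * (2 + ((P.d : ℝ) + 1) * (18 : ℝ) ^ P.d)) * (5200 * (((P.d + 2) * P.L : ℕ) : ℝ) ^ 2) / ((P.L : ℝ) * ((P.L : ℝ) - 1))) with hCA
  have hCA0 : 0 ≤ CA := by rw [hCA]; exact div_nonneg (by positivity) hLL.le
  have hA0 : 0 ≤ ((P.d : ℝ) + 1) * (P.L : ℝ) ^ k := by positivity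
  set ρD : ℝ := 2 * ((((P.d : ℝ) + 1) * (P.L : ℝ) ^ k * (2 * r))) + η₀ with hρDdef
  have hρD0 : 0 ≤ ρD := by rw [hρDdef]; positivity
  have hρD1 : ρD < 1 := lt_of_le_of_lt hρD (by norm_num)
  set β : ℝ := 8 * ρD + 2 * CA * ((((P.d : ℝ) + 1) * (P.L : ℝ) ^ k * (4 * r)) + (((P.d : ℝ) + 1) * (P.L : ℝ) ^ k * (2 * r + η))) +
      (2 * r + η) + (2 * ((((P.d : ℝ) + 1) * (P.L : ℝ) ^ k * η)) + η₀) with hβ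
  have hβ0 : 0 ≤ β := by rw [hβ]; positivity
  set Κ : ℝ := (((P.d : ℝ) + 1) * (P.L : ℝ) ^ k) * β with hΚ
  have hΚ0 : 0 ≤ Κ := mul_nonneg hA0 hβ0
  -- smallness at `(2r, η)` (for `Good`)
  have hmono : (((P.d : ℝ) + 1) * (P.L : ℝ) ^ k * (2 * r)) + (((P.d : ℝ) + 1) * (P.L : ℝ) ^ k * η) ≤
      (((P.d : ℝ) + 1) * (P.L : ℝ) ^ k * (4 * r)) + (((P.d : ℝ) + 1) * (P.L : ℝ) ^ k * (2 * r + η)) := by nlinarith [mul_nonneg hA0 hr.le]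
  have hm' := (mul_le_mul_of_nonneg_left hmono hCA0).trans h5200
  have h200' := (mul_le_mul_of_nonneg_left hmono (by positivity : (0 : ℝ) ≤ 200 * (((P.d + 2) * P.L : ℕ) : ℝ))).trans h200
  have hNδ' := lt_of_le_of_lt (mul_le_mul_of_nonneg_left hmono (by positivity : (0 : ℝ) ≤ 4 * (((P.d + 2) * P.L : ℕ) : ℝ))) hNδ
  -- the perturbed fields
  let fieldOf : (PBond P 0 → Matrix n n ℂ) → GaugeField P 0 (Matrix.specialUnitaryGroup n ℂ) := fun x b =>
    if h : x b ∈ lieSU n then expSU ⟨x b, h⟩ * U₀ b else U₀ b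
  have hfield : ∀ x : PBond P 0 → Matrix n n ℂ, (∀ b, x b ∈ lieSU n) → ∀ b,
      ((fieldOf x b : Matrix.specialUnitaryGroup n ℂ) : Matrix n n ℂ) = exp (x b) * (U₀ b : Matrix n n ℂ) := by
    intro x hx b
    have e : fieldOf x b = expSU ⟨x b, hx b⟩ * U₀ b := dif_pos (hx b)
    rw [e, Submonoid.coe_mul, coe_expSU]
  have hball : ∀ x : PBond P 0 → Matrix n n ℂ, ‖x‖ ≤ r → ∀ b, ‖x b‖ ≤ r := fun x hx b => (norm_le_pi_norm x b).trans hx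
  -- `Good`: in the ball the defect at `c ∈ C` is `ρ_D`-close to `1` ((B), local-gauge form)
  have hGood : ∀ x : PBond P 0 → Matrix n n ℂ, (∀ b, x b ∈ lieSU n) → ‖x‖ ≤ r → ∀ c ∈ C,
      ‖((Averaging.iter av k (fieldOf x) c : Matrix.specialUnitaryGroup n ℂ) : Matrix n n ℂ) * star ((V c : Matrix.specialUnitaryGroup n ℂ) : Matrix n n ℂ) - 1‖ ≤ ρD :=
    fun x hx hxr c hc => norm_defect_sub_one_le_framed_allL hk (σ c) (N c) c (hN c hc) U₀ (fieldOf x) V x (hfield x hx) hr2 hη (hball x hxr) (hU₀ c hc) (hV c hc) hm' h200' hNδ'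
  -- the defect map
  let Φ₀ : (PBond P 0 → Matrix n n ℂ) → PBond P k → Matrix n n ℂ := fun x c =>
    mlog (((Averaging.iter av k (fieldOf x) c : Matrix.specialUnitaryGroup n ℂ) : Matrix n n ℂ) * star ((V c : Matrix.specialUnitaryGroup n ℂ) : Matrix n n ℂ))
  -- the framed linearisation as a linear map
  let Tf : (PBond P 0 → Matrix n n ℂ) → PBond P k → Matrix n n ℂ := fun x c =>
    star (transfUp (σ c) k c.src : Matrix n n ℂ) * linAvgIterM k (fun b => ((σ c b.src : Matrix.specialUnitaryGroup n ℂ) : Matrix n n ℂ) * x b * star (σ c b.src : Matrix n n ℂ)) c *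
      (transfUp (σ c) k c.src : Matrix n n ℂ)
  have hTadd : ∀ x y : PBond P 0 → Matrix n n ℂ, Tf (x + y) = Tf x + Tf y := by
    intro x y; funext c
    simp only [Tf, Pi.add_apply]
    have e : (fun b : PBond P 0 => ((σ c b.src : Matrix.specialUnitaryGroup n ℂ) : Matrix n n ℂ) * (x b + y b) * star (σ c b.src : Matrix n n ℂ)) =
        (fun b : PBond P 0 => ((σ c b.src : Matrix.specialUnitaryGroup n ℂ) : Matrix n n ℂ) * x b * star (σ c b.src : Matrix n n ℂ)) +
          (fun b : PBond P 0 => ((σ c b.src : Matrix.specialUnitaryGroup n ℂ) : Matrix n n ℂ) * y b * star (σ c b.src : Matrix n n ℂ)) := by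
      funext b; simp only [Pi.add_apply]; noncomm_ring
    rw [e, ← avgCLM_apply k, map_add, Pi.add_apply, avgCLM_apply k, avgCLM_apply k]; noncomm_ring
  have hTsmul : ∀ (t : ℝ) (x : PBond P 0 → Matrix n n ℂ), Tf (t • x) = t • Tf x := by
    intro t x; funext c
    simp only [Tf, Pi.smul_apply]
    have e : (fun b : PBond P 0 => ((σ c b.src : Matrix.specialUnitaryGroup n ℂ) : Matrix n n ℂ) * (t • x b) * star (σ c b.src : Matrix n n ℂ)) =
        t • (fun b : PBond P 0 => ((σ c b.src : Matrix.specialUnitaryGroup n ℂ) : Matrix n n ℂ) * x b * star (σ c b.src : Matrix n n ℂ)) := by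
      funext b; simp only [Pi.smul_apply, mul_smul_comm, smul_mul_assoc]
    rw [e, ← avgCLM_apply k, map_smul, avgCLM_apply k, Pi.smul_apply, mul_smul_comm, smul_mul_assoc]
  let T₀ : (PBond P 0 → Matrix n n ℂ) →ₗ[ℝ] (PBond P k → Matrix n n ℂ) := { toFun := Tf, map_add' := hTadd, map_smul' := hTsmul }
  have hT₀ : ∀ x c, T₀ x c = Tf x c := fun _ _ => rfl
  -- hypotheses of the shell on supports
  have hT : ∀ x : PBond P 0 → Matrix n n ℂ, (∀ b, x b ∈ lieSU n) → ∀ c, T₀ x c ∈ lieSU n := by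
    intro x hx c
    rw [hT₀]
    exact star_conj_mem_lieSU (linAvgIterM_mem k (lieSU n) (fun b => conj_mem_lieSU' (hx b) _) c) _
  have hΦS : ∀ x : PBond P 0 → Matrix n n ℂ, (∀ b, x b ∈ lieSU n) → ‖x‖ ≤ r → ∀ c ∈ C, Φ₀ x c ∈ lieSU n :=
    fun x hx hxr c hc => mlog_defect_mem_lieSU _ _ (hGood x hx hxr c hc) hρD hρπ
  have hlin : ∀ x x' : PBond P 0 → Matrix n n ℂ, (∀ b, x b ∈ lieSU n) → (∀ b, x' b ∈ lieSU n) → ‖x‖ ≤ r → ‖x'‖ ≤ r →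
      ∀ c ∈ C, ‖Φ₀ x' c - Φ₀ x c - T₀ (x' - x) c‖ ≤ Κ * ‖x' - x‖ := by
    intro x x' hx hx' hxr hxr' c hc
    have hΔr : ‖x' - x‖ ≤ 2 * r := (norm_sub_le _ _).trans (by linarith)
    have h := norm_mlogDefect_sub_sub_framedAvg_le_allL hk (σ c) (N c) c (hN c hc) U₀ (fieldOf x) (fieldOf x') V x x' (hfield x hx) (hfield x' hx')
      hr2 hη hη₀ hΔr (hball x hxr) (hball x' hxr') (fun b => norm_le_pi_norm (x' - x) b) (hU₀ c hc) (hV c hc) h5200 h200 hNδ (by linarith [hρD])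
    rw [hT₀]
    exact h
  have hinv : ∀ u : PBond P k → Matrix n n ℂ, (∀ c, u c ∈ lieSU n) → (∀ c, c ∉ C → u c = 0) → ∀ c ∈ C, ‖T₀ (R₀ u) c - u c‖ ≤ κ * ‖u‖ := by
    intro u hu hu0 c hc
    rw [hT₀]
    exact hRinv u hu hu0 c hc
  have h0 : ∀ c ∈ C, ‖Φ₀ 0 c‖ ≤ 2 * η₀ := by
    intro c hc
    have hf0 : fieldOf 0 = U₀ := by
      funext b
      apply Subtype.ext
      rw [hfield 0 (fun _ => (lieSU n).zero_mem) b]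
      show exp ((0 : PBond P 0 → Matrix n n ℂ) b) * (U₀ b : Matrix n n ℂ) = _
      rw [Pi.zero_apply, exp_zero, one_mul]
    show ‖mlog (((Averaging.iter av k (fieldOf 0) c : Matrix.specialUnitaryGroup n ℂ) : Matrix n n ℂ) * star ((V c : Matrix.specialUnitaryGroup n ℂ) : Matrix n n ℂ))‖ ≤ 2 * η₀
    rw [hf0]
    have h4 : η₀ ≤ 1 / 4 := by
      have : 0 ≤ 2 * ((((P.d : ℝ) + 1) * (P.L : ℝ) ^ k * (2 * r))) := by positivity
      linarith [hρD]
    exact (norm_mlog_le_two_mul ((hV c hc).trans (by linarith))).trans (by linarith [hV c hc])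
  -- the constants of the shell
  have hq' : κ + Κ * (CR / Lk) ≤ 1 / 2 := by
    have e : Κ * (CR / Lk) = ((P.d : ℝ) + 1) * CR * β := by rw [hΚ, hLk]; field_simp
    rw [e, hβ, hρDdef, hCA]; exact hcontr
  have hq : κ + Κ * (CR / Lk) < 1 := by linarith
  set ρ : ℝ := r * Lk / CR with hρdef
  have hρ0 : 0 ≤ ρ := by rw [hρdef]; positivity
  have hρr : (CR / Lk) * ρ ≤ r := by
    rw [hρdef]; field_simp; exact le_rfl
  have hδρ : 2 * η₀ ≤ (1 - (κ + Κ * (CR / Lk))) * ρ := by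
    have h1 : (1 : ℝ) / 2 * ρ ≤ (1 - (κ + Κ * (CR / Lk))) * ρ := mul_le_mul_of_nonneg_right (by linarith) hρ0
    refine le_trans ?_ h1
    rw [hρdef, show (1:ℝ) / 2 * (r * Lk / CR) = (r * Lk) / (2 * CR) by field_simp, le_div_iff₀ (by positivity)]
    rw [hLk]; nlinarith
  -- THE SHELL ON SUPPORTS
  obtain ⟨u, huS, hu0, -, hRu, hΦu, hub⟩ := exists_zero_on_support_of_approxRightInverse (lieSU n) C Φ₀ T₀ R₀ hΚ0 hκ (by positivity : (0 : ℝ) ≤ CR / Lk) hq hρ0 hρr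
    (by positivity : (0 : ℝ) ≤ 2 * η₀) hδρ hT hRS hΦS hlin hinv hRn h0
  -- sizes
  have hu4 : ‖u‖ ≤ 4 * η₀ := by
    refine hub.trans ?_
    rw [div_le_iff₀ (by linarith)]
    nlinarith [hq']
  set a : PBond P 0 → Matrix n n ℂ := R₀ u with ha
  have haS : ∀ b, a b ∈ lieSU n := hRS u huS hu0
  have haδ : ∀ b, ‖a b‖ ≤ 4 * CR * η₀ / (P.L : ℝ) ^ k := by
    intro b
    refine (norm_le_pi_norm a b).trans ((hRn u huS hu0).trans ?_)
    rw [← hLk]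
    calc CR / Lk * ‖u‖ ≤ CR / Lk * (4 * η₀) := mul_le_mul_of_nonneg_left hu4 (by positivity)
      _ = 4 * CR * η₀ / Lk := by ring
  refine ⟨fieldOf a, u, a, huS, hu0, hu4, rfl, haS, haδ, hfield a haS, fun c hc => ?_⟩
  -- exactness on `C`
  have hg : ‖((Averaging.iter av k (fieldOf a) c : Matrix.specialUnitaryGroup n ℂ) : Matrix n n ℂ) * star ((V c : Matrix.specialUnitaryGroup n ℂ) : Matrix n n ℂ) - 1‖ < 1 :=
    lt_of_le_of_lt (hGood a haS hRu c hc) hρD1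
  exact eq_of_mlog_mul_star_eq_zero _ _ hg (hΦu c hc)

end Regional

/-! ## §3 The plaquette clause in a gauge, abstract kernel -/

section Plaquette

variable [Nonempty n]

/-- **★★ THE PLAQUETTE CLAUSE OF THE REGIONAL LIFT, IN A GAUGE.**  `U_b = e^{a_b}U₀,b` with `a = R₀ u` `𝔰𝔲(n)`-valued, `‖a_b‖ ≤ δ ≤ 1/4`, `‖u‖ ≤ 4η₀`; a finest plaquette `p` and ANY
finest gauge `g` with `U₀^g` `η_p`-flat on the four bonds of `p`; the kernel's CURL ROW IN THAT GAUGE `‖curl(b ↦ g(b₋)(R₀ u)_b g(b₋)*)(p)‖ ≤ (C_curl∕(L^k)²)·‖u‖` (★w3's (r1-curl) ∕ (C)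
`norm_curlM_conj_liftSMTw_le` for `liftSMTw`; the `obLift` port likewise).  THEN `dist1 U(∂p) ≤ dist1 U₀(∂p) + (C_curl∕(L^k)²)·4η₀ + 16η_p·δ + 16δ²` — this seat's
`PerturbedPlaquetteFrame.dist1_plaqHol_perturb_le_frame` + `exp_four_mul_sub_le_sq`. [cite: Balaban1985Averaging, (8)–(9) p.19, (19) p.21; Balaban1985Variational, (8) p.279] -/
theorem dist1_plaqHol_regional_le {k : ℕ} (U₀ U : GaugeField P 0 (Matrix.specialUnitaryGroup n ℂ)) (R₀ : (PBond P k → Matrix n n ℂ) →ₗ[ℝ] (PBond P 0 → Matrix n n ℂ))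
    (u : PBond P k → Matrix n n ℂ) (a : PBond P 0 → Matrix n n ℂ) (ha : a = R₀ u) (haS : ∀ b, a b ∈ lieSU n)
    (hU : ∀ b, ((U b : Matrix.specialUnitaryGroup n ℂ) : Matrix n n ℂ) = exp (a b) * (U₀ b : Matrix n n ℂ))
    {η₀ δ ηp Ccurl : ℝ} (hδ : 0 ≤ δ) (hδ4 : 4 * δ ≤ 1) (hCcurl : 0 ≤ Ccurl) (hu : ‖u‖ ≤ 4 * η₀) (haδ : ∀ b, ‖a b‖ ≤ δ)
    (p : Plaq P 0) (g : GaugeTransf P 0 (Matrix.specialUnitaryGroup n ℂ))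
    (h₁ : ‖((GaugeField.gaugeAct g U₀ ⟨p.src, p.μ⟩ : Matrix.specialUnitaryGroup n ℂ) : Matrix n n ℂ) - 1‖ ≤ ηp)
    (h₂ : ‖((GaugeField.gaugeAct g U₀ ⟨p.src.shift p.μ, p.ν⟩ : Matrix.specialUnitaryGroup n ℂ) : Matrix n n ℂ) - 1‖ ≤ ηp)
    (h₃ : ‖((GaugeField.gaugeAct g U₀ ⟨p.src.shift p.ν, p.μ⟩ : Matrix.specialUnitaryGroup n ℂ) : Matrix n n ℂ) - 1‖ ≤ ηp)
    (h₄ : ‖((GaugeField.gaugeAct g U₀ ⟨p.src, p.ν⟩ : Matrix.specialUnitaryGroup n ℂ) : Matrix n n ℂ) - 1‖ ≤ ηp)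
    (hcurl : ‖curlM (fun b : PBond P 0 => ((g b.src : Matrix.specialUnitaryGroup n ℂ) : Matrix n n ℂ) * R₀ u b * star (g b.src : Matrix n n ℂ)) p.src p.μ p.ν‖ ≤
      (Ccurl / ((P.L : ℝ) ^ k) ^ 2) * ‖u‖) :
    GaugeGroup.dist1 (GaugeField.plaqHol U p) ≤ GaugeGroup.dist1 (GaugeField.plaqHol U₀ p) + (Ccurl / ((P.L : ℝ) ^ k) ^ 2) * (4 * η₀) + 16 * ηp * δ + 16 * δ ^ 2 := by
  have hastar : ∀ b, star (a b) = -a b := fun b => (mem_lieSU_iff.1 (haS b)).1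
  have hP := dist1_plaqHol_perturb_le_frame g U₀ U a hastar hU p h₁ h₂ h₃ h₄ (haδ _) (haδ _) (haδ _) (haδ _)
  have hE := exp_four_mul_sub_le_sq hδ hδ4
  have hc : ‖((g p.src : Matrix.specialUnitaryGroup n ℂ) : Matrix n n ℂ) * a ⟨p.src, p.μ⟩ * star (g p.src : Matrix n n ℂ) +
        ((g (p.src.shift p.μ) : Matrix.specialUnitaryGroup n ℂ) : Matrix n n ℂ) * a ⟨p.src.shift p.μ, p.ν⟩ * star (g (p.src.shift p.μ) : Matrix n n ℂ) -
        ((g (p.src.shift p.ν) : Matrix.specialUnitaryGroup n ℂ) : Matrix n n ℂ) * a ⟨p.src.shift p.ν, p.μ⟩ * star (g (p.src.shift p.ν) : Matrix n n ℂ) -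
        ((g p.src : Matrix.specialUnitaryGroup n ℂ) : Matrix n n ℂ) * a ⟨p.src, p.ν⟩ * star (g p.src : Matrix n n ℂ)‖ ≤ (Ccurl / ((P.L : ℝ) ^ k) ^ 2) * (4 * η₀) := by
    rw [ha]
    exact hcurl.trans (mul_le_mul_of_nonneg_left hu (by positivity))
  linarith

end Plaquette

end Summit.QuantumFields.YangMills.Theorems.NewtonLiftFramed

end
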